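import Literature.Analysis.Distribution.TranslationQuasiInvariantSubstitution
import HarnessLib

/-!
# Shears along a block of untwisted directions do not change the block averages

Topic `Analysis/Distribution`; namespace `Literature.Analysis.Distribution`. Let `B` be a biorthogonal list
of directions with trivial characters (`λ_b = 0`) and let `u : X → X` take values in the span of the `v_b`,
`b ∈ B`, and be constant along every `B`-line. Then the shear `x ↦ x - u(x)` does not change the iterated
line averages over `B`:

  `A_B (f ∘ (id - u)) = A_B f`   (`lineAvgList_comp_sub_shear`).

One direction at a time (`lineAvg_comp_sub_shear`): along the `b`-line through `y`, `x - u(x)` is the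
reparametrised point `(s - φ_b(u y)) v_b + (y - u'(y))` with `u' = u - φ_b(u) v_b` in the span of the remaining
directions, so `A_b (f ∘ (id - u)) = (A_b f) ∘ (id - u')` by the translation invariance of the Lebesgue integral
(`λ_b = 0`) and `φ_b u' = 0`. This is the bookkeeping behind Hörmander, *ALPDO I*, Thm. 3.1.4' when the
translation group is replaced by a unipotent (sheared) action, as for the left action of `N` on the big Bruhat
cell. Everything is proved; no named fact is introduced.

## References

* L. Hörmander, *The Analysis of Linear Partial Differential Operators I* (1983/2003), Thm. 3.1.4'
  [HormanderALPDO1].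
-/

noncomputable section

open MeasureTheory Set Filter Topology Function
open scoped ContDiff ComplexConjugate

namespace Literature.Analysis.Distribution

variable {X : Type*} [NormedAddCommGroup X] [NormedSpace ℝ X]

/-- **Vector-valued line invariance**: `u (s v + (x - (φ x) v)) = u x`. [folklore] -/
def IsLineInvariantV (d : Direction X) (u : X → X) : Prop := ∀ (x : X) (s : ℝ), u (s • d.v + (x - (d.φ x) • d.v)) = u x

/-- A line-invariant vector field is invariant under `x ↦ x + t v`. [folklore] -/
theorem IsLineInvariantV.apply_add_smul {d : Direction X} {u : X → X} (hu : IsLineInvariantV d u) (x : X) (t : ℝ) :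
    u (x + t • d.v) = u x := by
  have h1 := hu (x + t • d.v) (d.φ x)
  rw [proj_add_smul d.v d.φ d.hφv, line_decomp] at h1
  exact h1.symm

/-- A line-invariant vector field takes the same value at `x` and at the base point `x - (φ x) v` of its line.
[folklore] -/
theorem IsLineInvariantV.apply_proj {d : Direction X} {u : X → X} (hu : IsLineInvariantV d u) (x : X) :
    u (x - (d.φ x) • d.v) = u x := by
  have h := hu x 0
  rwa [zero_smul, zero_add] at h

/-- **One direction**: for `λ_b = 0` and `u` constant along the `b`-lines,
`A_b (f ∘ (id - u)) = (A_b f) ∘ (id - u')`, `u' = u - φ_b(u) v_b`. [folklore] -/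
theorem lineAvg_comp_sub_shear (b : Direction X) (hlam : b.lam = 0) {u : X → X} (hu : IsLineInvariantV b u)
    (f : X → ℂ) :
    lineAvg b (fun x => f (x - u x)) = fun x => lineAvg b f (x - (u x - (b.φ (u x)) • b.v)) := by
  funext x
  rw [lineAvg_apply, lineAvg_apply]
  simp only [hlam, zero_mul, Complex.ofReal_zero, zero_mul, Complex.exp_zero, one_mul]
  -- the base point of the line through `x - u'(x)` is `y - u'(x)`, `y = x - (φ x) v`
  have hφu' : b.φ (u x - (b.φ (u x)) • b.v) = 0 := by
    rw [map_sub, map_smul, b.hφv, smul_eq_mul, mul_one, sub_self]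
  have hbase : x - (u x - (b.φ (u x)) • b.v) - (b.φ (x - (u x - (b.φ (u x)) • b.v))) • b.v =
      (x - (b.φ x) • b.v) - (u x - (b.φ (u x)) • b.v) := by
    rw [map_sub, hφu', sub_zero]; abel
  rw [hbase]
  -- along the line: `u (s v + y) = u x`, so the integrand is a translate in `s`
  have hline : ∀ s : ℝ, s • b.v + (x - (b.φ x) • b.v) - u (s • b.v + (x - (b.φ x) • b.v)) =
      (s - b.φ (u x)) • b.v + ((x - (b.φ x) • b.v) - (u x - (b.φ (u x)) • b.v)) := by
    intro s
    rw [hu x s, sub_smul]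
    abel
  simp_rw [hline]
  have h := integral_sub_right_eq_self (μ := volume)
    (fun s : ℝ => f (s • b.v + ((x - (b.φ x) • b.v) - (u x - (b.φ (u x)) • b.v)))) (b.φ (u x))
  exact h

/-- **The block shear lemma**: `λ_b = 0` on `B`, `B` biorthogonal, `u` with values in the span of the `v_b` and
constant along every `B`-line ⟹ `A_B (f ∘ (id - u)) = A_B f`. [folklore] -/
theorem lineAvgList_comp_sub_shear : ∀ (B : List (Direction X)) (_hB : Biorthogonal B) (_hlam : ∀ b ∈ B, b.lam = 0)
    {u : X → X} (_hspan : ∀ x, u x ∈ Submodule.span ℝ (Set.range fun b : {b // b ∈ B} => b.1.v))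
    (_hinv : ∀ b ∈ B, IsLineInvariantV b u) (f : X → ℂ),
    lineAvgList B (fun x => f (x - u x)) = lineAvgList B f
  | [], _, _, u, hspan, _, f => by
    funext x
    have h0 : u x = 0 := by
      have h := hspan x
      have hempty : (Set.range fun b : {b // b ∈ ([] : List (Direction X))} => b.1.v) = ∅ :=
        Set.range_eq_empty_iff.2 ⟨fun b => absurd b.2 List.not_mem_nil⟩
      rw [hempty, Submodule.span_empty, Submodule.mem_bot] at h
      exact h
    simp [lineAvgList, h0]
  | b :: B, hB, hlam, u, hspan, hinv, f => by
    obtain ⟨hb, hB'⟩ := biorthogonal_cons.1 hB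
    simp only [lineAvgList]
    rw [lineAvg_comp_sub_shear b (hlam b List.mem_cons_self) (hinv b List.mem_cons_self) f]
    -- the new field `u' = u - φ_b(u) v_b` takes values in the span of the tail and is still line-invariant
    set u' : X → X := fun x => u x - (b.φ (u x)) • b.v with hu'
    refine lineAvgList_comp_sub_shear B hB' (fun e he => hlam e (List.mem_cons_of_mem _ he)) (u := u') ?_ ?_ (lineAvg b f)
    · intro x
      -- decompose `u x` in the span of `v_b, (v_e)_{e ∈ B}`; the `b`-component is `φ_b (u x)`
      have hx := hspan x
      rw [show (Set.range fun e : {e // e ∈ b :: B} => e.1.v) = insert b.v (Set.range fun e : {e // e ∈ B} => e.1.v) by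
        ext w
        simp only [Set.mem_range, Set.mem_insert_iff, Subtype.exists, List.mem_cons, exists_prop]
        constructor
        · rintro ⟨e, (rfl | he), rfl⟩
          · exact Or.inl rfl
          · exact Or.inr ⟨e, he, rfl⟩
        · rintro (rfl | ⟨e, he, rfl⟩)
          · exact ⟨b, Or.inl rfl, rfl⟩
          · exact ⟨e, Or.inr he, rfl⟩, Submodule.span_insert, Submodule.mem_sup] at hx
      obtain ⟨y, hy, z, hz, hyz⟩ := hx
      obtain ⟨t, rfl⟩ := Submodule.mem_span_singleton.1 hy
      -- `φ_b (u x) = t` since `φ_b` kills the span of the tail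
      have hφz : b.φ z = 0 := by
        refine Submodule.span_induction (p := fun w _ => b.φ w = 0) ?_ (map_zero _) (fun _ _ _ _ h1 h2 => by rw [map_add, h1, h2, add_zero])
          (fun r _ _ h1 => by rw [map_smul, h1, smul_zero]) hz
        rintro _ ⟨⟨e, he⟩, rfl⟩
        exact (hb e he).1
      have ht : b.φ (u x) = t := by rw [← hyz, map_add, map_smul, b.hφv, hφz, smul_eq_mul, mul_one, add_zero]
      have : u' x = z := by rw [hu']; simp only; rw [ht, ← hyz]; abel
      rw [this]; exact hz
    · intro e he x s
      simp only [hu']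
      rw [(hinv e (List.mem_cons_of_mem _ he)) x s]

end Literature.Analysis.Distribution
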